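import Summits.CriticalPhenomena.PercolationContinuityZ3.Theorems.PercNearOneGluingNoHeavyLowerTailSahiCombTranslateRank

/-!
# Partial-flip Kleitman, and the dipole inequality whenever ONE of its two structure sets is SELF-DUAL (short counting proofs)

Support file of the one-cut programme (crux `NoHeavyLowerTail`, stmt-CriticalPhenomena-4575; cell `prim-masterthm`, seat P5 gen 21).

`FiveUpSet.DipoleIneq` (`…SahiCombTriWProdCube`; OPEN in general) asks, for up-sets `X, Y, h` of a cube `Finset α` and a translate `t`, for
`#(refl X ∩ Y ∩ h) + #(X ∩ refl Y ∩ h) + #(refl (X ∩ Y) ∩ h) ≤ 2·#(X ∩ Y ∩ h) + #(refl X ∩ transl t Y ∩ h)`; through the product-cube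
embedding it implies `TriWGenIneq` and the crux target `TriWIneq` (`triWIneq_of_dipoleIneq`).  An up-set `X` is SELF-DUAL when
`sᶜ ∈ X ↔ s ∉ X` (a maximal intersecting family: dictators, odd majorities, …; then `refl X = Xᶜ` and `#X = 2^{n-1}`).  This file proves the
inequality at every configuration in which `X` OR `Y` is self-dual:

* `FiveUpSet.card_inter_transl_le` — PARTIAL-FLIP KLEITMAN: for up-sets `A, U` and any `t`, `#(A ∩ transl t U) ≤ #(A ∩ U)` (flip the coordinates
  of `t` one at a time; one flip is an explicit injection, `card_inter_transl_singleton_le`, needing only closure under inserting that coordinate,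
  `card_inter_transl_le_of_closed`).  With the tree's translate lemma `card_inter_refl_le_card_inter_transl` (a rank argument) this sandwiches
  `#(A ∩ refl U) ≤ #(A ∩ transl t U) ≤ #(A ∩ U)`.
* `FiveUpSet.card_le_two_mul_card_inter_of_selfDual` — Harris–Kleitman for a self-dual up-set `X`: `#A ≤ 2·#(A ∩ X)` for every up-set `A`.
* **`FiveUpSet.dipoleIneq_of_selfDual_left`** — self-dual `X` (all up-sets `Y, h`, all `t`): with `refl X = Xᶜ` the claim reads
  `#(Y∩h) + #(refl Y ∩ h) + #(X ∩ transl t Y ∩ h) ≤ 3·#(X∩Y∩h) + #(transl t Y ∩ h)` = Harris + translate lemma + partial-flip Kleitman.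
* **`FiveUpSet.dipoleIneq_of_selfDual_right`** — self-dual `Y`: the claim reads `#(X∩h) + #(refl X ∩ h) ≤ 3·#(X∩Y∩h) + #(refl X ∩ transl t Y ∩ h)`;
  split `#(refl X ∩ h)` along `transl t Y`, whose complement is `refl (transl t Y)` (self-duality), and use
  `#(h ∩ refl (X ∩ transl t Y)) = #(h ∩ transl tᶜ (transl t X ∩ Y)) ≤ #(h ∩ transl t X ∩ Y) ≤ #(h ∩ X ∩ Y)` (partial-flip Kleitman twice — the middle family
  is closed under inserting the coordinates of `tᶜ`) and Harris `#(X∩h) ≤ 2·#(X∩Y∩h)`.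
The consequences for `triWGen` / `triW` (new strata "`F` self-dual", "`G` self-dual" of `TriWIneq`, every index cube) are in `…SahiCombTriWSelfDualFamily`.
Behind the proofs is the identity `TRI = Kl(𝒫;𝔽𝔾) + Σ_{u∈P} k_X(a_u,b_u) + Σ_x K^ω(F_{xᶜ};G_x)` with the ω-WEIGHTED antipodal agreement
`K^ω(F;G) = Σ_w ω(w)·[w ∈ G]([w ∈ F] − [wᶜ ∈ F])`, `ω = 1_P + 1_{refl P}`: `ω ≡ 1` exactly when `P` is self-dual, and then every term is a Kleitman gap
(seat notes, gen 21).  HONEST LABEL: unconditional lemmas with elementary proofs (std axioms); `DipoleIneq` itself remains OPEN. [this work]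
-/

namespace Summit.CriticalPhenomena.PercolationContinuityZ3.Theorems

namespace FiveUpSet

open Finset
open scoped symmDiff

variable {α : Type} [DecidableEq α] [Fintype α]

/-! ### Translates: composition, intersections, single coordinates -/

omit [Fintype α] in
/-- Translates compose: `transl a (transl b 𝒜) = transl (a ∆ b) 𝒜`. [this work] -/
theorem transl_transl (a b : Finset α) (𝒜 : Finset (Finset α)) : transl a (transl b 𝒜) = transl (a ∆ b) 𝒜 := by
  ext s
  rw [mem_transl, mem_transl, mem_transl, symmDiff_assoc]

omit [Fintype α] in
/-- Translation commutes with intersection. [this work] -/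
theorem transl_inter (a : Finset α) (𝒜 ℬ : Finset (Finset α)) : transl a (𝒜 ∩ ℬ) = transl a 𝒜 ∩ transl a ℬ := by
  ext s
  simp only [mem_transl, mem_inter]

omit [Fintype α] in
/-- Translating twice by the same set does nothing. [this work] -/
theorem transl_transl_self (a : Finset α) (𝒜 : Finset (Finset α)) : transl a (transl a 𝒜) = 𝒜 := by
  rw [transl_transl, symmDiff_self, Finset.bot_eq_empty, transl_empty]

/-- The antipodal image through a translate and its complement: `refl 𝒜 = transl tᶜ (transl t 𝒜)`. [this work] -/
theorem refl_eq_transl_compl_transl (t : Finset α) (𝒜 : Finset (Finset α)) : refl 𝒜 = transl tᶜ (transl t 𝒜) := by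
  rw [transl_transl, ← transl_univ]
  congr 1
  ext j
  simp only [mem_univ, mem_symmDiff, mem_compl, true_iff]
  tauto

omit [Fintype α] in
/-- `s ∆ {i} = insert i s` when `i ∉ s`. [folklore] -/
theorem symmDiff_singleton_eq_insert {i : α} {s : Finset α} (h : i ∉ s) : s ∆ {i} = insert i s := by
  ext j
  simp only [mem_symmDiff, mem_singleton, mem_insert]
  by_cases hj : j = i
  · subst hj; simp [h]
  · simp [hj]

omit [Fintype α] in
/-- `{i} ∆ t = insert i t` when `i ∉ t`. [folklore] -/
theorem singleton_symmDiff_eq_insert {i : α} {t : Finset α} (h : i ∉ t) : {i} ∆ t = insert i t := by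
  rw [symmDiff_comm]; exact symmDiff_singleton_eq_insert h

omit [Fintype α] in
/-- A family closed under inserting a coordinate `i ∉ t` stays so after translation by `t`. [this work] -/
theorem insert_mem_transl_of_not_mem {i : α} {t : Finset α} (hit : i ∉ t) {V : Finset (Finset α)}
    (hV : ∀ s ∈ V, insert i s ∈ V) : ∀ s ∈ transl t V, insert i s ∈ transl t V := by
  intro s hs
  rw [mem_transl] at hs ⊢
  have e : insert i s ∆ t = insert i (s ∆ t) := by
    ext j
    simp only [mem_symmDiff, mem_insert]
    by_cases hj : j = i
    · subst hj; simp [hit]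
    · simp [hj]
  rw [e]
  exact hV _ hs

/-! ### Partial-flip Kleitman -/

omit [Fintype α] in
/-- ONE-COORDINATE FLIP.  If `A` and `V` are both closed under inserting the coordinate `i`, then
`#(A ∩ transl {i} V) ≤ #(A ∩ V)`: the map `s ↦ s` (if `s ∈ V`) / `s ↦ s ∆ {i}` (otherwise) is an injection of the left family into the right one. [this work] -/
theorem card_inter_transl_singleton_le {i : α} {A V : Finset (Finset α)}
    (hA : ∀ s ∈ A, insert i s ∈ A) (hV : ∀ s ∈ V, insert i s ∈ V) :
    (A ∩ transl {i} V).card ≤ (A ∩ V).card := by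
  refine Finset.card_le_card_of_injOn (fun s => if s ∈ V then s else s ∆ {i}) ?_ ?_
  · intro s hs
    rw [mem_coe, mem_inter, mem_transl] at hs
    rw [mem_coe, mem_inter]
    dsimp only
    by_cases hsV : s ∈ V
    · rw [if_pos hsV]; exact ⟨hs.1, hsV⟩
    · rw [if_neg hsV]
      refine ⟨?_, hs.2⟩
      -- `i ∉ s`, for otherwise `s = insert i (s ∆ {i}) ∈ V`
      have his : i ∉ s := by
        intro hi
        apply hsV
        have e : s ∆ {i} = s.erase i := by
          ext j
          simp only [mem_symmDiff, mem_singleton, mem_erase]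
          by_cases hj : j = i
          · subst hj; simp [hi]
          · simp [hj]
        have h2 := hV _ hs.2
        rw [e, insert_erase hi] at h2
        exact h2
      rw [symmDiff_singleton_eq_insert his]
      exact hA _ hs.1
  · intro s₁ hs₁ s₂ hs₂ heq
    rw [coe_inter, Set.mem_inter_iff, mem_coe, mem_coe, mem_transl] at hs₁ hs₂
    dsimp only at heq
    by_cases h1 : s₁ ∈ V <;> by_cases h2 : s₂ ∈ V
    · rwa [if_pos h1, if_pos h2] at heq
    · rw [if_pos h1, if_neg h2] at heq
      exfalso; apply h2
      have e : s₂ = s₁ ∆ {i} := by rw [heq, symmDiff_symmDiff_cancel_right]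
      rw [e]; exact hs₁.2
    · rw [if_neg h1, if_pos h2] at heq
      exfalso; apply h1
      have e : s₁ = s₂ ∆ {i} := by rw [← heq, symmDiff_symmDiff_cancel_right]
      rw [e]; exact hs₂.2
    · rw [if_neg h1, if_neg h2] at heq
      exact symmDiff_left_injective ({i} : Finset α) heq

omit [Fintype α] in
/-- PARTIAL FLIP, closed families: if `A` and `V` are closed under inserting every coordinate of `t`, then `#(A ∩ transl t V) ≤ #(A ∩ V)`
(flip the coordinates of `t` one at a time). [this work] -/
theorem card_inter_transl_le_of_closed (t : Finset α) {A V : Finset (Finset α)}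
    (hA : ∀ i ∈ t, ∀ s ∈ A, insert i s ∈ A) (hV : ∀ i ∈ t, ∀ s ∈ V, insert i s ∈ V) :
    (A ∩ transl t V).card ≤ (A ∩ V).card := by
  induction t using Finset.induction_on generalizing V with
  | empty => rw [transl_empty]
  | @insert i t hit ih =>
    have e : transl (insert i t) V = transl {i} (transl t V) := by
      rw [transl_transl, singleton_symmDiff_eq_insert hit]
    rw [e]
    calc (A ∩ transl {i} (transl t V)).card
        ≤ (A ∩ transl t V).card :=
          card_inter_transl_singleton_le (hA i (mem_insert_self i t))
            (insert_mem_transl_of_not_mem hit (hV i (mem_insert_self i t)))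
      _ ≤ (A ∩ V).card :=
          ih (fun j hj => hA j (mem_insert_of_mem hj)) (fun j hj => hV j (mem_insert_of_mem hj))

omit [Fintype α] in
/-- **PARTIAL-FLIP KLEITMAN.**  For up-sets `A, U` of a cube and any `t`: `#(A ∩ transl t U) ≤ #(A ∩ U)` — inside an up-set, flipping some coordinates
of an up-set can only lose points.  (`t = univ`: Kleitman's antipodal lemma `card_inter_refl_le`; the reverse comparison with the full flip is the tree's
translate lemma `card_inter_refl_le_card_inter_transl`.) [this work] -/
theorem card_inter_transl_le {A U : Finset (Finset α)} (hA : IsUpperSet (A : Set (Finset α)))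
    (hU : IsUpperSet (U : Set (Finset α))) (t : Finset α) : (A ∩ transl t U).card ≤ (A ∩ U).card :=
  card_inter_transl_le_of_closed t (fun i _ s hs => hA (subset_insert i s) hs) (fun i _ s hs => hU (subset_insert i s) hs)

/-! ### Self-dual up-sets -/

/-- A self-dual family is the complement of its antipodal image. [this work] -/
theorem refl_eq_compl_of_selfDual {X : Finset (Finset α)} (hX : ∀ s : Finset α, sᶜ ∈ X ↔ s ∉ X) : refl X = Xᶜ := by
  ext s
  rw [mem_refl, mem_compl]
  exact hX s

/-- A self-dual family has exactly half of the cube. [this work] -/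
theorem two_mul_card_of_selfDual {X : Finset (Finset α)} (hX : ∀ s : Finset α, sᶜ ∈ X ↔ s ∉ X) :
    2 * X.card = 2 ^ Fintype.card α := by
  have h2 : X.card + Xᶜ.card = 2 ^ Fintype.card α := by
    rw [Finset.card_add_card_compl, Fintype.card_finset]
  rw [← refl_eq_compl_of_selfDual hX, card_refl] at h2
  omega

/-- **Harris–Kleitman for a self-dual up-set**: `#A ≤ 2·#(A ∩ X)` for every up-set `A`. [this work] -/
theorem card_le_two_mul_card_inter_of_selfDual {A X : Finset (Finset α)} (hA : IsUpperSet (A : Set (Finset α)))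
    (hXu : IsUpperSet (X : Set (Finset α))) (hX : ∀ s : Finset α, sᶜ ∈ X ↔ s ∉ X) :
    A.card ≤ 2 * (A ∩ X).card := by
  have h := hA.le_card_inter_finset hXu
  have h2 := two_mul_card_of_selfDual hX
  have hXpos : 0 < X.card := by
    have : 0 < 2 ^ Fintype.card α := Nat.pos_of_ne_zero (by positivity)
    omega
  rw [← h2] at h
  have h' : A.card * X.card ≤ (2 * (A ∩ X).card) * X.card := by
    calc A.card * X.card ≤ 2 * X.card * (A ∩ X).card := h
      _ = (2 * (A ∩ X).card) * X.card := by ring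
  exact Nat.le_of_mul_le_mul_right h' hXpos

/-! ### The dipole inequality with a self-dual structure set -/

/-- **The dipole inequality for self-dual `X`.**  For a self-dual up-set `X`, up-sets `Y, h` and any translate `t`:
`#(refl X ∩ Y ∩ h) + #(X ∩ refl Y ∩ h) + #(refl (X ∩ Y) ∩ h) ≤ 2·#(X ∩ Y ∩ h) + #(refl X ∩ transl t Y ∩ h)`. [this work] -/
theorem dipoleIneq_of_selfDual_left (X Y h : Finset (Finset α)) (t : Finset α)
    (hXu : IsUpperSet (X : Set (Finset α))) (hX : ∀ s : Finset α, sᶜ ∈ X ↔ s ∉ X)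
    (hY : IsUpperSet (Y : Set (Finset α))) (hh : IsUpperSet (h : Set (Finset α))) :
    (refl X ∩ Y ∩ h).card + (X ∩ refl Y ∩ h).card + (refl (X ∩ Y) ∩ h).card
      ≤ 2 * (X ∩ Y ∩ h).card + (refl X ∩ transl t Y ∩ h).card := by
  have hXc : refl X = Xᶜ := refl_eq_compl_of_selfDual hX
  -- the three `refl X`-terms as differences
  have e1 : (refl X ∩ Y ∩ h).card + (X ∩ Y ∩ h).card = (Y ∩ h).card := by
    have s1 : refl X ∩ Y ∩ h = (Y ∩ h) \ X := by
      rw [hXc]; ext s; simp only [mem_inter, mem_compl, mem_sdiff]; tauto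
    have s2 : X ∩ Y ∩ h = (Y ∩ h) ∩ X := by
      ext s; simp only [mem_inter]; tauto
    rw [s1, s2, card_sdiff_add_card_inter]
  have e3 : (refl (X ∩ Y) ∩ h).card + (X ∩ refl Y ∩ h).card = (refl Y ∩ h).card := by
    have s1 : refl (X ∩ Y) ∩ h = (refl Y ∩ h) \ X := by
      rw [refl_inter, hXc]; ext s; simp only [mem_inter, mem_compl, mem_sdiff]; tauto
    have s2 : X ∩ refl Y ∩ h = (refl Y ∩ h) ∩ X := by
      ext s; simp only [mem_inter]; tauto
    rw [s1, s2, card_sdiff_add_card_inter]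
  have e5 : (refl X ∩ transl t Y ∩ h).card + (X ∩ h ∩ transl t Y).card = (transl t Y ∩ h).card := by
    have s1 : refl X ∩ transl t Y ∩ h = (transl t Y ∩ h) \ X := by
      rw [hXc]; ext s; simp only [mem_inter, mem_compl, mem_sdiff]; tauto
    have s2 : X ∩ h ∩ transl t Y = (transl t Y ∩ h) ∩ X := by
      ext s; simp only [mem_inter]; tauto
    rw [s1, s2, card_sdiff_add_card_inter]
  -- the three estimates
  have hXh : IsUpperSet ((X ∩ h : Finset (Finset α)) : Set (Finset α)) := by
    rw [coe_inter]; exact hXu.inter hh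
  have hYh : IsUpperSet ((Y ∩ h : Finset (Finset α)) : Set (Finset α)) := by
    rw [coe_inter]; exact hY.inter hh
  have i1 : (X ∩ h ∩ transl t Y).card ≤ (X ∩ h ∩ Y).card := card_inter_transl_le hXh hY t
  have i1' : X ∩ h ∩ Y = X ∩ Y ∩ h := by ext s; simp only [mem_inter]; tauto
  rw [i1'] at i1
  have i2 : (h ∩ refl Y).card ≤ (h ∩ transl t Y).card := card_inter_refl_le_card_inter_transl hh hY t
  rw [inter_comm h (refl Y), inter_comm h (transl t Y)] at i2
  have i3 : (Y ∩ h).card ≤ 2 * (Y ∩ h ∩ X).card := card_le_two_mul_card_inter_of_selfDual hYh hXu hX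
  have i3' : Y ∩ h ∩ X = X ∩ Y ∩ h := by ext s; simp only [mem_inter]; tauto
  rw [i3'] at i3
  omega

/-- The complement of a translate of a self-dual family is the antipodal image of that translate. [this work] -/
theorem compl_transl_of_selfDual {Y : Finset (Finset α)} (hY : ∀ s : Finset α, sᶜ ∈ Y ↔ s ∉ Y) (t : Finset α) :
    (transl t Y)ᶜ = refl (transl t Y) := by
  ext s
  rw [mem_compl, mem_transl, mem_refl, mem_transl, ← hY]
  have e : (s ∆ t)ᶜ = sᶜ ∆ t := by
    ext j
    simp only [mem_compl, mem_symmDiff]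
    tauto
  rw [e]

/-- **The dipole inequality for self-dual `Y`.**  For an up-set `X`, a self-dual up-set `Y`, an up-set `h` and any translate `t`:
`#(refl X ∩ Y ∩ h) + #(X ∩ refl Y ∩ h) + #(refl (X ∩ Y) ∩ h) ≤ 2·#(X ∩ Y ∩ h) + #(refl X ∩ transl t Y ∩ h)`. [this work] -/
theorem dipoleIneq_of_selfDual_right (X Y h : Finset (Finset α)) (t : Finset α)
    (hXu : IsUpperSet (X : Set (Finset α))) (hYu : IsUpperSet (Y : Set (Finset α)))
    (hY : ∀ s : Finset α, sᶜ ∈ Y ↔ s ∉ Y) (hh : IsUpperSet (h : Set (Finset α))) :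
    (refl X ∩ Y ∩ h).card + (X ∩ refl Y ∩ h).card + (refl (X ∩ Y) ∩ h).card
      ≤ 2 * (X ∩ Y ∩ h).card + (refl X ∩ transl t Y ∩ h).card := by
  have hYc : refl Y = Yᶜ := refl_eq_compl_of_selfDual hY
  -- the two `refl Y`-terms as differences
  have e2 : (X ∩ refl Y ∩ h).card + (X ∩ Y ∩ h).card = (X ∩ h).card := by
    have s1 : X ∩ refl Y ∩ h = (X ∩ h) \ Y := by
      rw [hYc]; ext s; simp only [mem_inter, mem_compl, mem_sdiff]; tauto
    have s2 : X ∩ Y ∩ h = (X ∩ h) ∩ Y := by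
      ext s; simp only [mem_inter]; tauto
    rw [s1, s2, card_sdiff_add_card_inter]
  have e3 : (refl (X ∩ Y) ∩ h).card + (refl X ∩ Y ∩ h).card = (refl X ∩ h).card := by
    have s1 : refl (X ∩ Y) ∩ h = (refl X ∩ h) \ Y := by
      rw [refl_inter, hYc]; ext s; simp only [mem_inter, mem_compl, mem_sdiff]; tauto
    have s2 : refl X ∩ Y ∩ h = (refl X ∩ h) ∩ Y := by
      ext s; simp only [mem_inter]; tauto
    rw [s1, s2, card_sdiff_add_card_inter]
  -- split `refl X ∩ h` along `transl t Y`; its complement is `refl (transl t Y)`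
  have e4 : ((refl X ∩ h) \ transl t Y).card + (refl X ∩ transl t Y ∩ h).card = (refl X ∩ h).card := by
    have s2 : refl X ∩ transl t Y ∩ h = (refl X ∩ h) ∩ transl t Y := by
      ext s; simp only [mem_inter]; tauto
    rw [s2, card_sdiff_add_card_inter]
  have e4' : (refl X ∩ h) \ transl t Y = h ∩ transl tᶜ (transl t X ∩ Y) := by
    rw [sdiff_eq_inter_compl, compl_transl_of_selfDual hY]
    have e : transl tᶜ (transl t X ∩ Y) = refl (X ∩ transl t Y) := by
      rw [refl_eq_transl_compl_transl t (X ∩ transl t Y), transl_inter t, transl_transl_self]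
    rw [e, refl_inter]
    ext s; simp only [mem_inter]; tauto
  -- the estimates
  have hXt : ∀ i ∈ tᶜ, ∀ s ∈ transl t X ∩ Y, insert i s ∈ transl t X ∩ Y := by
    intro i hi s hs
    rw [mem_compl] at hi
    rw [mem_inter] at hs ⊢
    exact ⟨insert_mem_transl_of_not_mem hi (fun u hu => hXu (subset_insert i u) hu) s hs.1,
      hYu (subset_insert i s) hs.2⟩
  have i1 : (h ∩ transl tᶜ (transl t X ∩ Y)).card ≤ (h ∩ (transl t X ∩ Y)).card :=
    card_inter_transl_le_of_closed tᶜ (fun i _ s hs => hh (subset_insert i s) hs) hXt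
  have hYh : IsUpperSet ((h ∩ Y : Finset (Finset α)) : Set (Finset α)) := by
    rw [coe_inter]; exact hh.inter hYu
  have i2 : (h ∩ Y ∩ transl t X).card ≤ (h ∩ Y ∩ X).card := card_inter_transl_le hYh hXu t
  have i2a : h ∩ (transl t X ∩ Y) = h ∩ Y ∩ transl t X := by ext s; simp only [mem_inter]; tauto
  have i2b : h ∩ Y ∩ X = X ∩ Y ∩ h := by ext s; simp only [mem_inter]; tauto
  rw [i2a] at i1
  rw [i2b] at i2
  have hXh : IsUpperSet ((X ∩ h : Finset (Finset α)) : Set (Finset α)) := by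
    rw [coe_inter]; exact hXu.inter hh
  have i3 : (X ∩ h).card ≤ 2 * (X ∩ h ∩ Y).card := card_le_two_mul_card_inter_of_selfDual hXh hYu hY
  have i3' : X ∩ h ∩ Y = X ∩ Y ∩ h := by ext s; simp only [mem_inter]; tauto
  rw [i3'] at i3
  rw [e4'] at e4
  omega

end FiveUpSet

end Summit.CriticalPhenomena.PercolationContinuityZ3.Theorems
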